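import Mathlib.NumberTheory.Padics.PadicNorm
import Mathlib.Tactic
import HarnessLib

/-!
# Venture HSemireg — MOD-4 OFF THE SPLIT FAMILY: the `p`-adic core of LEMMA ν, part 1 (skeleton + ramified primes)
# (row (F-4) of the W3 table; seat `w3-mod4-1`, files of record `widen/W3/MOD4-OFFSPLIT-w3mod4.md` v1.0 §7,
# `widen/W3/MOD4-OFFSPLIT-THEOREMS-w3mod4.md` v1.0; companion file `Mod4BranchGValuation.lean` = part 2)

HONEST FRAMING. Lean index of the computation cell `pub-hsemireg`, widening seat `w3-mod4-1` (W3 «special fibres»,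
the MOD-4 law off the split family). ELEMENTARY `p`-ADIC ARITHMETIC OF RATIONAL NUMBERS ONLY (Mathlib's `padicNorm`):
no abelian variety, no sheaf, no Mukai vector, no Ext group and no semiregularity map is constructed here; the
geometric inputs of THEOREM G (LEMMA PIN, LEMMA HRR-SPLIT, TABLE R, LEMMA RR-FIBRE, and the frame data (a) «q₅ ∈ ℤ_(p)»
/ (b) «p ∣ Q_χ(Λ_W)») are NOT formalised. Nothing here says that HC, HC_CM or HC_AV holds, and nothing here is a new
case of anything.

*What it indexes (on paper, NOT in this file).* For a K-secant h-part `f(h) = x e^{μh} + x̄ e^{μ̄h}` over the Weil field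
`K = ℚ(√-m)` one has `q_k := k! · (h^k-coefficient of f) = Tr_{K/ℚ}(x μ^k)`; writing `μ = a + b√-m`, `S := Tr μ = 2a`,
`P := Nm μ = a² + m b²`, the `q_k` satisfy `q_{k+2} = S q_{k+1} - P q_k`, the discriminant is
`Δ := -(μ - μ̄)² = 4 m b² = 4P - S²`, and `Nm(q₁ - q₀ μ̄) = q₁² - S q₀ q₁ + P q₀²` (`normForm` below).  The branch
invariant of THEOREM B is `ν(f) := -P_f(q)/2` with `P_f(q) = Σ_j (-1)^j C(6,j) q_j q_{6-j}` (LEMMA HRR-SPLIT: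
`χ(f(h), f(h)) = D · P_f(q)`); `neg_half_Pf_eq` checks the pencil identity `ν(f) = Δ² · Nm(q₁ - q₀ μ̄)` (= `Δ³ Nm x`).

CONTENT (all PROVED, 0 sorry, two computable `def`s `normForm` / `qseq`, no named facts), namespace
`Summit.Ventures.HSemireg.Mod4`, for a prime `p`:
* `norm_nu_le_of_cases` — the SKELETON of LEMMA ν: if `q₀, q₁, q₅, q₆ ∈ ℤ_(p)` (i.e. `padicNorm p · ≤ 1`) and the slope
  data satisfy (A0) `|P| ≤ 1 → |S| ≤ 1`, (B) `|P| ≤ 1 → |S| ≤ 1 → |4P - S²| ≤ p⁻¹`, (A) `1 < |P| → |S|² ≤ |P|`, then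
  `|Δ² · Nm(q₁ - q₀ μ̄)|_p ≤ p⁻²`.  Case `|P| ≤ 1` is the pencil case (B); case `|P| > 1` is the pencil case (A), run through
  the identity `Nm(q₆ - q₅ μ̄) = P⁵ · Nm(q₁ - q₀ μ̄)` (`normForm_qseq`).
* `lemma_nu_ramified` — **LEMMA ν** for every prime `p` and every `m ∈ ℚ` with `|m|_p = p⁻¹` (all odd primes ramified
  in `ℚ(√-m)`, `m` squarefree; and `p = 2` for `m ≡ 2 mod 4`): the three slope conditions hold by the PARITY of the
  exponent of `|4 m b²|_p = p⁻¹ |2b|_p²` (`ramified_norm_S_sq_le`, `ramified_norm_delta_le`), hence `|ν(f)|_p ≤ p⁻²`;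
  an `example` records that the bound is attained (`K = ℚ(√-3)`, `μ = (1+√-3)/2`, `(q₀,q₁) = (1,0)`, `ν = 9`).
Part 2 (`Mod4BranchGValuation.lean`): the case `p = 2`, `m ≡ 1 (mod 4)` and the last line of THEOREM G.

Pencil ⇄ kernel dictionary: pencil `v_p(x) ≥ k` is `padicNorm p x ≤ p^(-k)`; the pencil's `x ∈ ℤ_(p)` is
`padicNorm p x ≤ 1` (WEAKER than the sheet's `q₀, q₁ ∈ ℤ`, so the kernel statements are slightly STRONGER); the
pencil's case split on `v_π(μ) < 0` is the split on `1 < |Nm μ|_p`.  The sheet's sharper field-by-field minima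
(`v_p(ν) ≥ 2 / 4 / 6 / 2` for `ℚ(√-3) / ℚ(i) / ℚ(√-2) / ℚ(√-7)`, machine-checked there) are NOT reproduced: `≥ 2` is
what THEOREM G consumes.
-/

namespace Summit.Ventures.HSemireg

namespace Mod4

variable {p : ℕ} [hp : Fact p.Prime]

section Helpers

/-! ### `p`-adic bookkeeping on `ℚ` (thin wrappers around Mathlib's `padicNorm`; the seven one-line wrappers that
also exist verbatim in unrelated tree files are kept `private` to this file, and re-declared privately where the
companion files need them) -/

/-- `1 < p` in `ℚ`. -/
private theorem one_lt_p_cast : (1 : ℚ) < p := by exact_mod_cast hp.out.one_lt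

/-- `0 < p` in `ℚ`. -/
private theorem p_cast_pos : (0 : ℚ) < p := by exact_mod_cast hp.out.pos

/-- `p ≠ 1` in `ℚ`. -/
theorem p_cast_ne_one : (p : ℚ) ≠ 1 := ne_of_gt one_lt_p_cast

omit hp in
/-- Discreteness: a nonzero rational has `p`-adic norm an integral power of `p`. -/
theorem exists_norm_eq_zpow {x : ℚ} (hx : x ≠ 0) : ∃ z : ℤ, padicNorm p x = (p : ℚ) ^ z := by
  obtain ⟨z, hz⟩ := padicNorm.values_discrete (p := p) hx
  exact ⟨-z, hz⟩

/-- `1 < |x|_p` forces `p ≤ |x|_p` (pencil: `v_p(x) < 0 ⇒ v_p(x) ≤ -1`). -/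
theorem p_le_norm_of_one_lt {x : ℚ} (h : 1 < padicNorm p x) : (p : ℚ) ≤ padicNorm p x := by
  have hx : x ≠ 0 := by
    rintro rfl
    rw [padicNorm.zero] at h
    exact absurd h (by norm_num)
  obtain ⟨z, hz⟩ := exists_norm_eq_zpow (p := p) hx
  rw [hz] at h ⊢
  have h1 : (p : ℚ) ^ (0 : ℤ) < (p : ℚ) ^ z := by simpa using h
  rw [zpow_lt_zpow_iff_right₀ one_lt_p_cast] at h1
  calc (p : ℚ) = (p : ℚ) ^ (1 : ℤ) := by simp
    _ ≤ (p : ℚ) ^ z := (zpow_le_zpow_iff_right₀ one_lt_p_cast).mpr (by omega)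

/-- Nonarchimedean bound for a sum. -/
private theorem norm_add_le {x y t : ℚ} (hx : padicNorm p x ≤ t) (hy : padicNorm p y ≤ t) :
    padicNorm p (x + y) ≤ t :=
  le_trans padicNorm.nonarchimedean (max_le hx hy)

/-- Nonarchimedean bound for a difference. -/
private theorem norm_sub_le {x y t : ℚ} (hx : padicNorm p x ≤ t) (hy : padicNorm p y ≤ t) :
    padicNorm p (x - y) ≤ t :=
  le_trans padicNorm.sub (max_le hx hy)

/-- Strict nonarchimedean bound for a difference. -/
theorem norm_sub_lt {x y t : ℚ} (hx : padicNorm p x < t) (hy : padicNorm p y < t) :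
    padicNorm p (x - y) < t :=
  lt_of_le_of_lt padicNorm.sub (max_lt hx hy)

/-- `|x·y|_p ≤ t` from `|x|_p ≤ t` and `|y|_p ≤ 1`. -/
theorem norm_mul_le_left {x y t : ℚ} (hx : padicNorm p x ≤ t) (hy : padicNorm p y ≤ 1) :
    padicNorm p (x * y) ≤ t := by
  rw [padicNorm.mul]
  calc padicNorm p x * padicNorm p y ≤ padicNorm p x * 1 :=
        mul_le_mul_of_nonneg_left hy (padicNorm.nonneg _)
    _ = padicNorm p x := mul_one _
    _ ≤ t := hx

/-- `|x·y|_p ≤ t` from `|x|_p ≤ 1` and `|y|_p ≤ t`. -/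
theorem norm_mul_le_right {x y t : ℚ} (hx : padicNorm p x ≤ 1) (hy : padicNorm p y ≤ t) :
    padicNorm p (x * y) ≤ t := by
  rw [mul_comm]; exact norm_mul_le_left hy hx

/-- The `p`-adic norm of a power. -/
private theorem norm_pow (x : ℚ) (n : ℕ) : padicNorm p (x ^ n) = padicNorm p x ^ n := by
  induction n with
  | zero => simp
  | succ n ih => rw [pow_succ, padicNorm.mul, ih, pow_succ]

/-- `|x^n|_p ≤ 1` from `|x|_p ≤ 1`. -/
private theorem norm_pow_le_one {x : ℚ} (hx : padicNorm p x ≤ 1) (n : ℕ) : padicNorm p (x ^ n) ≤ 1 := by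
  rw [norm_pow]; exact pow_le_one₀ (padicNorm.nonneg _) hx

/-- If `|y|_p < |x|_p` then `|x + y|_p = |x|_p`. -/
theorem norm_add_eq_left_of_lt {x y : ℚ} (h : padicNorm p y < padicNorm p x) :
    padicNorm p (x + y) = padicNorm p x := by
  rw [padicNorm.add_eq_max_of_ne h.ne', max_eq_left (le_of_lt h)]

/-- If `|x|_p < |y|_p` then `|x - y|_p = |y|_p`. -/
theorem norm_sub_eq_right_of_lt {x y : ℚ} (h : padicNorm p x < padicNorm p y) :
    padicNorm p (x - y) = padicNorm p y := by
  rw [sub_eq_add_neg, add_comm, norm_add_eq_left_of_lt (by simpa using h), padicNorm.neg]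

/-- A natural number has norm at most one. -/
private theorem norm_natCast_le_one (n : ℕ) : padicNorm p (n : ℚ) ≤ 1 := padicNorm.of_nat (p := p) n

/-- An integer has norm at most one. -/
theorem norm_intCast_le_one (z : ℤ) : padicNorm p (z : ℚ) ≤ 1 := padicNorm.of_int (p := p) z

/-- Exponent bookkeeping: `p⁻¹ · (p^i)² = p^(2i-1)`. -/
theorem inv_mul_zpow_sq (i : ℤ) : (p : ℚ)⁻¹ * ((p : ℚ) ^ i) ^ 2 = (p : ℚ) ^ (2 * i - 1) := by
  have hp0 : (p : ℚ) ≠ 0 := ne_of_gt p_cast_pos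
  rw [sq, ← zpow_neg_one, ← zpow_add₀ hp0, ← zpow_add₀ hp0]
  congr 1; ring

/-- Exponent bookkeeping: `(p^i)² = p^(2i)`. -/
theorem zpow_sq' (i : ℤ) : ((p : ℚ) ^ i) ^ 2 = (p : ℚ) ^ (2 * i) := by
  have hp0 : (p : ℚ) ≠ 0 := ne_of_gt p_cast_pos
  rw [sq, ← zpow_add₀ hp0]
  congr 1; ring

end Helpers

section SecantArithmetic

/-! ### The norm form and the Chern-character sequence of a K-secant h-part -/

/-- The binary norm form of the slope: `normForm S P u v = v² - S·u·v + P·u² = Nm_{K/ℚ}(v - u·μ̄)` for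
`S = Tr μ`, `P = Nm μ`.  With `(u, v) = (q₀, q₁)` this is `Δ · Nm(x)` for the K-secant h-part `x e^{μh} + x̄ e^{μ̄h}`. -/
def normForm (S P u v : ℚ) : ℚ := v ^ 2 - S * u * v + P * u ^ 2

/-- The norm form is multiplied by `P = Nm μ` under one step of the recurrence (`Nm(μ·y) = Nm μ · Nm y`). -/
theorem normForm_step (S P u v : ℚ) : normForm S P v (S * v - P * u) = P * normForm S P u v := by
  unfold normForm; ring

/-- The sequence `q_k = Tr(x μ^k)` (`k! ·` the `h^k`-coefficient of the h-part) from its first two terms: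
`q_{k+2} = S·q_{k+1} - P·q_k`. -/
def qseq (S P r q₁ : ℚ) : ℕ → ℚ
  | 0 => r
  | 1 => q₁
  | (n + 2) => S * qseq S P r q₁ (n + 1) - P * qseq S P r q₁ n

/-- `qseq` starts at `q₀ = r`. -/
@[simp] theorem qseq_zero (S P r q₁ : ℚ) : qseq S P r q₁ 0 = r := rfl

/-- `qseq` has `q₁` as its second term. -/
@[simp] theorem qseq_one (S P r q₁ : ℚ) : qseq S P r q₁ 1 = q₁ := rfl

/-- The recurrence of `qseq`. -/
theorem qseq_add_two (S P r q₁ : ℚ) (n : ℕ) :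
    qseq S P r q₁ (n + 2) = S * qseq S P r q₁ (n + 1) - P * qseq S P r q₁ n := rfl

/-- `Nm(q_{k+1} - q_k μ̄) = (Nm μ)^k · Nm(q₁ - q₀ μ̄)`: the norm form along the sequence. -/
theorem normForm_qseq (S P r q₁ : ℚ) (k : ℕ) :
    normForm S P (qseq S P r q₁ k) (qseq S P r q₁ (k + 1)) = P ^ k * normForm S P r q₁ := by
  induction k with
  | zero => simp
  | succ k ih =>
    rw [show k + 1 + 1 = k + 2 from rfl, qseq_add_two, normForm_step, ih, pow_succ]
    ring

/-- The pencil identity behind `ν(f) = Δ³ Nm(x)`: with `P_f(q) = Σ_{j=0}^{6} (-1)^j C(6,j) q_j q_{6-j}` one has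
`-P_f(q)/2 = (4P - S²)² · Nm(q₁ - q₀ μ̄)`. -/
theorem neg_half_Pf_eq (S P r q₁ : ℚ) :
    -(qseq S P r q₁ 0 * qseq S P r q₁ 6 - 6 * (qseq S P r q₁ 1 * qseq S P r q₁ 5)
        + 15 * (qseq S P r q₁ 2 * qseq S P r q₁ 4) - 20 * (qseq S P r q₁ 3 * qseq S P r q₁ 3)
        + 15 * (qseq S P r q₁ 4 * qseq S P r q₁ 2) - 6 * (qseq S P r q₁ 5 * qseq S P r q₁ 1)
        + qseq S P r q₁ 6 * qseq S P r q₁ 0) / 2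
      = (4 * P - S ^ 2) ^ 2 * normForm S P r q₁ := by
  simp only [qseq, normForm]
  ring

/-- **Skeleton of LEMMA ν.**  If `q₀, q₁, q₅, q₆ ∈ ℤ_(p)` and the slope data `(S, P) = (Tr μ, Nm μ)` satisfy
(A0) `|P|_p ≤ 1 → |S|_p ≤ 1`, (B) `|P|_p ≤ 1 → |S|_p ≤ 1 → |4P - S²|_p ≤ p⁻¹`, (A) `1 < |P|_p → |S|_p² ≤ |P|_p`, then
`|(4P - S²)² · Nm(q₁ - q₀ μ̄)|_p ≤ p⁻²`, i.e. `v_p(ν(f)) ≥ 2`. -/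
theorem norm_nu_le_of_cases (S P r q₁ : ℚ)
    (hr : padicNorm p r ≤ 1) (hq₁ : padicNorm p q₁ ≤ 1)
    (hq₅ : padicNorm p (qseq S P r q₁ 5) ≤ 1) (hq₆ : padicNorm p (qseq S P r q₁ 6) ≤ 1)
    (hA0 : padicNorm p P ≤ 1 → padicNorm p S ≤ 1)
    (hB : padicNorm p P ≤ 1 → padicNorm p S ≤ 1 → padicNorm p (4 * P - S ^ 2) ≤ (p : ℚ)⁻¹)
    (hA : 1 < padicNorm p P → padicNorm p S ^ 2 ≤ padicNorm p P) :
    padicNorm p ((4 * P - S ^ 2) ^ 2 * normForm S P r q₁) ≤ ((p : ℚ) ^ 2)⁻¹ := by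
  have hp0 : (0 : ℚ) < p := p_cast_pos
  rcases le_or_gt (padicNorm p P) 1 with hP | hP
  · -- pencil case (B): the slope is integral at π
    have hS : padicNorm p S ≤ 1 := hA0 hP
    have hΔ : padicNorm p (4 * P - S ^ 2) ≤ (p : ℚ)⁻¹ := hB hP hS
    have hN : padicNorm p (normForm S P r q₁) ≤ 1 := by
      unfold normForm
      refine norm_add_le (norm_sub_le (norm_pow_le_one hq₁ 2) ?_) ?_
      · exact norm_mul_le_left (norm_mul_le_left hS hr) hq₁
      · exact norm_mul_le_left hP (norm_pow_le_one hr 2)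
    rw [padicNorm.mul, norm_pow]
    calc padicNorm p (4 * P - S ^ 2) ^ 2 * padicNorm p (normForm S P r q₁)
        ≤ ((p : ℚ)⁻¹) ^ 2 * 1 := by
          apply mul_le_mul _ hN (padicNorm.nonneg _) (by positivity)
          exact pow_le_pow_left₀ (padicNorm.nonneg _) hΔ 2
      _ = ((p : ℚ) ^ 2)⁻¹ := by rw [mul_one, inv_pow]
  · -- pencil case (A): `v_π(μ) = -e < 0`; run through `Nm(q₆ - q₅ μ̄) = P⁵ Nm(q₁ - q₀ μ̄)`
    have hPpos : 0 < padicNorm p P := lt_trans one_pos hP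
    have hpP : (p : ℚ) ≤ padicNorm p P := p_le_norm_of_one_lt hP
    have hS2 : padicNorm p S ^ 2 ≤ padicNorm p P := hA hP
    have hS1 : padicNorm p S ≤ padicNorm p P := by
      rcases le_or_gt (padicNorm p S) 1 with h1 | h1
      · exact le_trans h1 (le_of_lt hP)
      · calc padicNorm p S = padicNorm p S * 1 := (mul_one _).symm
          _ ≤ padicNorm p S * padicNorm p S :=
              mul_le_mul_of_nonneg_left (le_of_lt h1) (padicNorm.nonneg _)
          _ = padicNorm p S ^ 2 := (sq _).symm
          _ ≤ padicNorm p P := hS2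
    have h4 : padicNorm p (4 : ℚ) ≤ 1 := by exact_mod_cast norm_natCast_le_one (p := p) 4
    have hΔ : padicNorm p (4 * P - S ^ 2) ≤ padicNorm p P := by
      refine norm_sub_le (norm_mul_le_right h4 le_rfl) ?_
      rw [norm_pow]; exact hS2
    have hN'' : padicNorm p (normForm S P (qseq S P r q₁ 5) (qseq S P r q₁ 6)) ≤ padicNorm p P := by
      unfold normForm
      refine norm_add_le (norm_sub_le ?_ ?_) ?_
      · exact le_trans (norm_pow_le_one hq₆ 2) (le_of_lt hP)
      · exact norm_mul_le_left (norm_mul_le_left hS1 hq₅) hq₆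
      · exact norm_mul_le_left le_rfl (norm_pow_le_one hq₅ 2)
    have hid := normForm_qseq S P r q₁ 5
    have hN' : padicNorm p (normForm S P r q₁) * padicNorm p P ^ 5 ≤ padicNorm p P := by
      calc padicNorm p (normForm S P r q₁) * padicNorm p P ^ 5
          = padicNorm p (P ^ 5 * normForm S P r q₁) := by rw [padicNorm.mul, norm_pow, mul_comm]
        _ = padicNorm p (normForm S P (qseq S P r q₁ 5) (qseq S P r q₁ 6)) := by rw [hid]
        _ ≤ padicNorm p P := hN''
    -- assemble: |Δ|² |N'| ≤ |P|² · |P| / |P|⁵ = |P|⁻² ≤ p⁻²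
    have hN'2 : padicNorm p (normForm S P r q₁) ≤ padicNorm p P / padicNorm p P ^ 5 := by
      rw [le_div_iff₀ (by positivity)]; exact hN'
    rw [padicNorm.mul, norm_pow]
    calc padicNorm p (4 * P - S ^ 2) ^ 2 * padicNorm p (normForm S P r q₁)
        ≤ padicNorm p P ^ 2 * (padicNorm p P / padicNorm p P ^ 5) := by
          apply mul_le_mul _ hN'2 (padicNorm.nonneg _) (by positivity)
          exact pow_le_pow_left₀ (padicNorm.nonneg _) hΔ 2
      _ = (padicNorm p P ^ 2)⁻¹ := by
          field_simp
      _ ≤ ((p : ℚ) ^ 2)⁻¹ := by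
          apply inv_anti₀ (by positivity)
          exact pow_le_pow_left₀ (le_of_lt hp0) hpP 2

end SecantArithmetic

section Ramified

/-! ### LEMMA ν at a prime `p` with `|m|_p = p⁻¹` (every odd prime ramified in `ℚ(√-m)`; `p = 2` when `m ≡ 2 mod 4`) -/

/-- In the ramified situation the trace is controlled by the norm: `|2a|_p² ≤ |4(a² + m b²)|_p`
(pencil: `v_π(μ + μ̄) ≥ min(v_π μ, v_π μ̄) = v_π μ`; kernel: the exponent of `|4 m b²|_p = p⁻¹·|2b|_p²` is ODD while
that of `|(2a)²|_p` is EVEN, so `|(2a)²|_p` can never be the dominant term of `4(a² + m b²) = (2a)² + 4 m b²`). -/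
theorem ramified_norm_S_sq_le (m a b : ℚ) (hm : padicNorm p m = (p : ℚ)⁻¹) :
    padicNorm p (2 * a) ^ 2 ≤ padicNorm p (4 * (a ^ 2 + m * b ^ 2)) := by
  by_contra h
  rw [not_le] at h
  have hΔ : 4 * (a ^ 2 + m * b ^ 2) - (2 * a) ^ 2 = m * (2 * b) ^ 2 := by ring
  have h1 : padicNorm p (4 * (a ^ 2 + m * b ^ 2) - (2 * a) ^ 2) = padicNorm p (2 * a) ^ 2 := by
    rw [norm_sub_eq_right_of_lt (by rwa [norm_pow]), norm_pow]
  rw [hΔ, padicNorm.mul, norm_pow, hm] at h1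
  have hS0 : 2 * a ≠ 0 := by
    intro h0
    rw [h0, padicNorm.zero, zero_pow two_ne_zero] at h
    exact absurd h (not_lt.mpr (padicNorm.nonneg _))
  have hb0 : 2 * b ≠ 0 := by
    intro h0
    rw [h0, padicNorm.zero] at h1
    have h2 : padicNorm p (2 * a) ^ 2 = 0 := by rw [← h1]; simp
    exact hS0 (padicNorm.zero_of_padicNorm_eq_zero ((pow_eq_zero_iff two_ne_zero).mp h2))
  obtain ⟨i, hi⟩ := exists_norm_eq_zpow (p := p) hS0
  obtain ⟨j, hj⟩ := exists_norm_eq_zpow (p := p) hb0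
  rw [hi, hj, inv_mul_zpow_sq, zpow_sq', zpow_right_inj₀ p_cast_pos p_cast_ne_one] at h1
  omega

/-- Case (B) of LEMMA ν in the ramified situation: an integral slope (`|Nm μ|_p ≤ 1`, `|Tr μ|_p ≤ 1`) has
`|Δ|_p = |4 Nm μ - (Tr μ)²|_p ≤ p⁻¹` (pencil: `δ = v_π(μ - μ̄) ≥ 1`; kernel: `|Δ|_p = p^(2j-1) ≤ 1` forces `2j - 1 ≤ -1`). -/
theorem ramified_norm_delta_le (m a b : ℚ) (hm : padicNorm p m = (p : ℚ)⁻¹)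
    (hP : padicNorm p (a ^ 2 + m * b ^ 2) ≤ 1) (hS : padicNorm p (2 * a) ≤ 1) :
    padicNorm p (4 * (a ^ 2 + m * b ^ 2) - (2 * a) ^ 2) ≤ (p : ℚ)⁻¹ := by
  have hΔ : 4 * (a ^ 2 + m * b ^ 2) - (2 * a) ^ 2 = m * (2 * b) ^ 2 := by ring
  have h4 : padicNorm p (4 : ℚ) ≤ 1 := by exact_mod_cast norm_natCast_le_one (p := p) 4
  have hle : padicNorm p (m * (2 * b) ^ 2) ≤ 1 := by
    rw [← hΔ]
    exact norm_sub_le (norm_mul_le_right h4 hP) (norm_pow_le_one hS 2)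
  rw [hΔ]
  by_cases hb0 : 2 * b = 0
  · have h0 : padicNorm p (m * (2 * b) ^ 2) = 0 := by rw [hb0]; simp
    rw [h0]
    exact le_of_lt (inv_pos.mpr p_cast_pos)
  obtain ⟨j, hj⟩ := exists_norm_eq_zpow (p := p) hb0
  rw [padicNorm.mul, norm_pow, hm, hj, inv_mul_zpow_sq] at hle ⊢
  have h0 : (2 * j - 1 : ℤ) ≤ 0 := by
    rw [← zpow_le_zpow_iff_right₀ (one_lt_p_cast (p := p)), zpow_zero]; exact hle
  rw [← zpow_neg_one]
  exact (zpow_le_zpow_iff_right₀ one_lt_p_cast).mpr (by omega)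

/-- **LEMMA ν (ramified prime).**  Let `p` be a prime and `m ∈ ℚ` with `|m|_p = p⁻¹` (e.g. `m` squarefree and
`p` an odd prime factor of `m`, or `p = 2` and `m ≡ 2 mod 4` — the primes ramified in `K = ℚ(√-m)` apart from
`p = 2, m ≡ 1 mod 4`).  For a K-secant h-part with slope `μ = a + b√-m` (`S = 2a`, `P = a² + m b²`, `Δ = 4 m b²`) whose
`q₀ = r`, `q₁`, `q₅`, `q₆` are `p`-integral, `ν(f) = Δ² · Nm(q₁ - q₀ μ̄)` satisfies `|ν(f)|_p ≤ p⁻²`, i.e.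
`v_p(ν(f)) ≥ 2`.  (Sheet: MOD4-OFFSPLIT-THEOREMS v1.0, LEMMA ν; there with `q₀, q₁ ∈ ℤ`.) -/
theorem lemma_nu_ramified (m a b r q₁ : ℚ) (hm : padicNorm p m = (p : ℚ)⁻¹)
    (hr : padicNorm p r ≤ 1) (hq₁ : padicNorm p q₁ ≤ 1)
    (hq₅ : padicNorm p (qseq (2 * a) (a ^ 2 + m * b ^ 2) r q₁ 5) ≤ 1)
    (hq₆ : padicNorm p (qseq (2 * a) (a ^ 2 + m * b ^ 2) r q₁ 6) ≤ 1) :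
    padicNorm p ((4 * m * b ^ 2) ^ 2 * normForm (2 * a) (a ^ 2 + m * b ^ 2) r q₁)
      ≤ ((p : ℚ) ^ 2)⁻¹ := by
  have hΔ : 4 * m * b ^ 2 = 4 * (a ^ 2 + m * b ^ 2) - (2 * a) ^ 2 := by ring
  have h4 : padicNorm p (4 : ℚ) ≤ 1 := by exact_mod_cast norm_natCast_le_one (p := p) 4
  have hSP := ramified_norm_S_sq_le (p := p) m a b hm
  rw [hΔ]
  refine norm_nu_le_of_cases _ _ r q₁ hr hq₁ hq₅ hq₆ ?_ ?_ ?_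
  · intro hP
    have h' : padicNorm p (2 * a) ^ 2 ≤ 1 := le_trans hSP (norm_mul_le_right h4 hP)
    exact (pow_le_one_iff_of_nonneg (padicNorm.nonneg _) two_ne_zero).mp h'
  · intro hP hS
    exact ramified_norm_delta_le m a b hm hP hS
  · intro _
    exact le_trans hSP (norm_mul_le_right h4 le_rfl)

/-- Sharpness / non-vacuity witness for `lemma_nu_ramified` at `K = ℚ(√-3)`, `p = 3`: the unit slope
`μ = (1 + √-3)/2` (`a = b = 1/2`, `S = P = 1`, `Δ = 3`) with `(q₀, q₁) = (1, 0)` has `q = (1, 0, -1, -1, 0, 1, 1)`, all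
integral, and `ν = Δ² · 1 = 9` of `3`-adic norm exactly `3⁻²`. -/
example : padicNorm 3 ((4 * 3 * (1 / 2 : ℚ) ^ 2) ^ 2
      * normForm (2 * (1 / 2)) ((1 / 2) ^ 2 + 3 * (1 / 2) ^ 2) 1 0) = ((3 : ℚ) ^ 2)⁻¹
    ∧ qseq (2 * (1 / 2 : ℚ)) ((1 / 2) ^ 2 + 3 * (1 / 2) ^ 2) 1 0 5 = 1
    ∧ qseq (2 * (1 / 2 : ℚ)) ((1 / 2) ^ 2 + 3 * (1 / 2) ^ 2) 1 0 6 = 1 := by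
  refine ⟨?_, ?_, ?_⟩
  · have e : (4 * 3 * (1 / 2 : ℚ) ^ 2) ^ 2 * normForm (2 * (1 / 2)) ((1 / 2) ^ 2 + 3 * (1 / 2) ^ 2) 1 0
        = (3 : ℚ) ^ 2 := by
      simp only [normForm]; norm_num
    have h3 : padicNorm 3 (3 : ℚ) = 3⁻¹ := by exact_mod_cast padicNorm.padicNorm_p_of_prime (p := 3)
    rw [e, norm_pow, h3, inv_pow]
  · simp only [qseq]; norm_num
  · simp only [qseq]; norm_num

end Ramified

end Mod4

end Summit.Ventures.HSemireg
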